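import Summits.AtomisticToContinuum.Crystallization.Theses.ExcessDecayLiouville
import Summits.AtomisticToContinuum.Crystallization.Theorems.CoarseGrains.Negative.PredicateAPI
import Summits.AtomisticToContinuum.Crystallization.Theorems.ChargedEnergyGap.Negative.Unconditional
import Literature.Probability.Process.RootedHardCoreVague
import Literature.Probability.Process.LocalRubberHardCore
import Literature.MathematicalPhysics.StatisticalMechanics.RootEnergy
import Literature.MathematicalPhysics.StatisticalMechanics.LocalLimitOfGroundStates
import Literature.MathematicalPhysics.StatisticalMechanics.LennardJonesClusters
import Mathlib.MeasureTheory.Integral.Bochner.Basic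
import Mathlib.Order.Filter.ENNReal

/-!
# Skeleton line `hcp-free-phase-exclusion` for crux `CoarseGrains` (stmt-AtomisticToContinuum-9331) — lead rev. 1

Route `ExcessDecayLiouville`, sub-problem `Crystallization`.  Lead `prover-line-stmt-AtomisticToContinuum-9331-1`
(2026-08-16), reshaping the planner's skeleton (`cruxplan-…-hcp-free-phase-exclu-0`, 3 stubs) into SEVEN
registered stubs typed on the compact metric space `Cfg` of rooted `δLJ`-hard-core configurations
(`Literature.Probability.Process.RootedHardCoreConfig`), `δLJ` = the uniform minimal distance of
Lennard-Jones ground states: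

* `stub_bsLimit` (M–L): Prokhorov + Lévy–Prokhorov metrisability on the compact `Cfg`: the uniformly
  re-rooted empirical laws of a family of finite `δLJ`-separated configurations have a weakly convergent
  subsequence, with the portmanteau lower bound for OPEN sets as a particle-count transfer;
* `stub_tailBound` (M): uniform `r⁻⁶` tail of the Lennard-Jones root energy over `Cfg` (shell counting);
* `stub_rootEnergyContinuous` (L): the root energy `S ↦ ½ ∑_{y ∈ S} V_LJ ‖y‖` is continuous on `Cfg`
  (uniform limit of the continuous local functionals `continuous_integral_toMeasure`);
* `stub_supportLocalLimit` (L): a weak limit of empirical laws of ground states with `n → ∞` is carried by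
  the class `𝔏` of local limits of ground states (support ⊆ 𝔏 via the open-set transfer and the diagonal
  lemma `IsLocalLimitOfGroundStates.of_eventually_ballMatch`);
* `stub_empiricalStationary` (M): the empirical law satisfies the Mecke identity on `Cfg` exactly
  (re-rooting `S_i` at `x_k − x_i` is `S_k`; a finite double sum);
* `stub_stationaryClosed` (L–XL, the lead's own): point-stationarity on `Cfg` is closed under weak limits
  (Campbell measures `count|S(dy) Q(dS)` on `Cfg × ℝ³`, continuity of `S ↦ ∑_{y∈S} G(S,y)` and of
  re-rooting, uniqueness of locally finite measures from bounded continuous integrals);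
* `stub_palmCoarseHcp` (open-problem, LOAD-BEARING, unchanged in content): no minimising
  point-stationary `𝔏`-carried law on `Cfg` is hcp-free at `(1/41, R + 1)`.

The composition `coarseGrains_of_stubs` / `CoarseGrains_of` is sorry-free: `¬CoarseGrains` at radius `R`
gives grain-free ground states `x_k` with `n_k ≥ k + 1` particles; `stub_bsLimit` gives `φ`, `Q`; the
energy identity `E(n)/n = ∫ rootEnergyC d(empirical)` (PROVED here, `integral_rootEnergyC_empirical`) with
`stub_rootEnergyContinuous ∘ stub_tailBound` and the PROVED `CrysEnergyLimit` (0626,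
`ChargedEnergyGapNegative.crysEnergyLimit`) make `Q` minimising; `stub_empiricalStationary` +
`stub_stationaryClosed` make it point-stationary; `stub_supportLocalLimit` puts it on `𝔏`;
`stub_palmCoarseHcp` charges the grain event; its localisation `T_L` has an OPEN fattening `U_L` in `Cfg`
(`isOpen_setOf_locallyMatches`) of positive mass, the transfer clause returns a particle whose recentred
configuration is `(L + R + 1, 1/1640)`-matched to a configuration carrying a `(1/41, R + 1)`-grain with
centre `‖c‖ ≤ L`, and the margin portmanteau `1/41 + 1/1640 = 1/40` (PROVED, `near_of_locallyMatches`) plus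
translation covariance (PROVED, `near_translate`) contradict grain-freeness.

Typing on `Cfg` (instead of `Measure (Measure E3)` as in the planner's skeleton) removes the
measurable-embedding / outer-measure transfer over arbitrary `T ⊆ Measure E3` flagged in the planner's
docstring: only open sets of `Cfg` are transferred.  Disproof.lean rev. 4 read: no `_false_without_` theorem
bites (minimality enters through `E_Q[h] ≤ e*`, largeness through `n_k → ∞`, separation through `δLJ`).

The vocabulary block below is byte-identical to `Theorems/ExcessDecayLiouvilleCoarseGrainsPalmDefs.lean`
(proposed; replaced by an `import` once it lands).
-/

noncomputable section

open MeasureTheory Filter Topology Set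
open scoped ENNReal
open Literature.MathematicalPhysics.StatisticalMechanics
open Literature.Probability.Process
open Summit.AtomisticToContinuum.Crystallization.Theorems.CoarseGrains.Negative.PredicateAPI

/-! ## Vocabulary (= `Theorems/ExcessDecayLiouvilleCoarseGrainsPalmDefs.lean`) -/

namespace Summit.AtomisticToContinuum.Crystallization.Theorems.ExcessDecayLiouvilleCoarseGrains.Palm

/-- The uniform minimal distance of Lennard-Jones ground states in `ℝ³` (a witness of the proved
Literature fact `LennardJonesMinimalDistance`). [folklore] -/
def δLJ : ℝ := Classical.choose LennardJonesMinimalDistance_holds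

/-- `δLJ > 0` and every Lennard-Jones ground state is `δLJ`-separated. [folklore] -/
theorem δLJ_spec : 0 < δLJ ∧ ∀ (N : ℕ) (x : Fin N → EuclideanSpace ℝ (Fin 3)),
    IsGroundState lennardJones x → ∀ i j : Fin N, i ≠ j → δLJ ≤ dist (x i) (x j) :=
  Classical.choose_spec LennardJonesMinimalDistance_holds

/-- `δLJ > 0`. [folklore] -/
theorem δLJ_pos : 0 < δLJ := δLJ_spec.1

/-- Lennard-Jones ground states are `δLJ`-separated. [folklore] -/
theorem δLJ_sep {N : ℕ} {x : Fin N → EuclideanSpace ℝ (Fin 3)} (hx : IsGroundState lennardJones x) :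
    ∀ i j : Fin N, i ≠ j → δLJ ≤ dist (x i) (x j) :=
  δLJ_spec.2 N x hx

/-- `Fact (0 < δLJ)`, unlocking the metric / compact structure of `RootedHardCoreConfig E3 δLJ`.
[folklore] -/
instance fact_δLJ_pos : Fact (0 < δLJ) := ⟨δLJ_pos⟩

/-- **The configuration space of the line**: rooted `δLJ`-hard-core configurations of `ℝ³` with
the local rubber metric — a compact metric space (`RootedHardCoreConfig.instCompactSpace`). [folklore] -/
abbrev Cfg : Type := LocalConfig.RootedHardCoreConfig E3 δLJ

/-- The point set of a configuration. [folklore] -/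
abbrev pts (S : Cfg) : Set E3 := ((S.1 : LocalConfig E3) : Set E3)

/-- The counting measure `count|S` of a configuration. [folklore] -/
abbrev cfgMeasure (S : Cfg) : Measure E3 := (S.1 : LocalConfig E3).toMeasure

/-- **Root energy on `Cfg`**: `rootEnergyC S = rootEnergy V_LJ (count|S) = ½ ∫ V_LJ ‖y‖ d(count|S)`.
[folklore] -/
def rootEnergyC (S : Cfg) : ℝ := rootEnergy lennardJones (cfgMeasure S)

/-- **The empirical rooted law** of a finite `δLJ`-separated configuration `x : Fin n → ℝ³`:
`(1/n) ∑ᵢ δ_{S_i}`, `S_i = {x_k − x_i | k}` the configuration seen from particle `i`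
(`RootedHardCoreConfig.ofFinite`).  A probability measure on `Cfg` for `n ≥ 1` (the zero measure for
`n = 0`). [folklore] -/
def empirical {n : ℕ} (x : Fin n → E3) (hsep : ∀ j k : Fin n, j ≠ k → δLJ ≤ dist (x j) (x k)) :
    Measure Cfg :=
  (n : ℝ≥0∞)⁻¹ • ∑ i : Fin n, Measure.dirac (LocalConfig.RootedHardCoreConfig.ofFinite x hsep i)

/-- **Re-rooting, total version**: `rerootAt S y = S − y` re-rooted at `y` when `y ∈ S`
(`RootedHardCoreConfig.reroot`), and the junk value `S` otherwise. [folklore] -/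
def rerootAt (S : Cfg) (y : E3) : Cfg :=
  open scoped Classical in
  if h : y ∈ pts S then LocalConfig.RootedHardCoreConfig.reroot S y h else S

/-- **Point-stationarity on `Cfg`** (Mecke / mass-transport identity): for every jointly measurable
`g : Cfg → ℝ³ → ℝ≥0∞`, `∫ ∑_{y ∈ S} g(S, y) Q(dS) = ∫ ∑_{y ∈ S} g(S − y, −y) Q(dS)` — the Campbell
measure `count|S (dy) Q(dS)` is invariant under the involution `(S, y) ↦ (S − y, −y)`.  This is
`Literature.Probability.Process.IsPointStationaryLaw` transported to the compact carrier space `Cfg`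
(`toMeasure_reroot`: re-rooting is the shift `μ ↦ μ.map (· − y)`). [folklore] -/
def IsPointStationaryC (Q : Measure Cfg) : Prop :=
  ∀ g : Cfg → E3 → ℝ≥0∞, Measurable (Function.uncurry g) →
    ∫⁻ S, ∫⁻ y, g S y ∂(cfgMeasure S) ∂Q = ∫⁻ S, ∫⁻ y, g (rerootAt S y) (-y) ∂(cfgMeasure S) ∂Q

/-- The reference energy `e* = ⨅` over periodic configurations of `ℝ³` of the Lennard-Jones energy per
particle. [folklore] -/
def eStar : ℝ := ⨅ Q : PeriodicConfiguration 3, Q.energyPerParticle lennardJones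

/-- **The hcp-grain event at radius `R`** on `Cfg` (tolerance `1/41`, radius `R + 1`): configurations
containing, ANYWHERE, a closed ball of radius `R + 1` two-way `1/41`-matched with an admissible affine hcp
two-lattice with hcp-like inner displacement (`Near`, `Adm`, `Inner` are the crux's own predicates,
`Negative.PredicateAPI`). [folklore] -/
def GrainSet (R : ℝ) : Set Cfg :=
  {S | ∃ (c : E3) (t : Fin 2 → E3) (A : E3 →L[ℝ] E3), Adm A ∧ Inner t A ∧ Near (pts S) c (R + 1) t A (1 / 41)}

end Summit.AtomisticToContinuum.Crystallization.Theorems.ExcessDecayLiouvilleCoarseGrains.Palm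

/-! ## The line -/

namespace Summit.AtomisticToContinuum.Crystallization.Cruxes.CoarseGrains.HcpFreePhaseExclusion

open Summit.AtomisticToContinuum.Crystallization.Theorems.ExcessDecayLiouvilleCoarseGrains.Palm
open LocalConfig (RootedHardCoreConfig)

/-! ### Registered stubs -/

/-- **stub_bsLimit** (M–L; Benjamini–Schramm compactness on `Cfg` with the open-set transfer).  For finite
`δLJ`-separated configurations `x k` with `n k ≥ 1` particles: a subsequence `φ` and a probability law `Q`
on `Cfg` such that (i) the empirical laws converge weakly to `Q` (integrals of every continuous
`f : Cfg → ℝ` converge — `Cfg` is compact, so continuous = bounded continuous) and (ii) for every OPEN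
`U ⊆ Cfg` and `ρ < Q U`, eventually at least `ρ · n (φ j)` particles `i` of `x (φ j)` have their re-rooted
configuration `ofFinite (x (φ j)) _ i` in `U`.  Proof: `CompactSpace (ProbabilityMeasure Cfg)`
(`Mathlib.MeasureTheory.Measure.Prokhorov`) + `MetrizableSpace (ProbabilityMeasure Cfg)` (Lévy–Prokhorov,
`Cfg` separable metric) ⇒ `SeqCompactSpace.tendsto_subseq`; (i) is
`ProbabilityMeasure.tendsto_iff_forall_integral_tendsto`; (ii) is
`ProbabilityMeasure.le_liminf_measure_open_of_tendsto` with `empirical U = #{i : S_i ∈ U}/n`. -/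
theorem stub_bsLimit :
    ∀ (n : ℕ → ℕ) (x : (k : ℕ) → (Fin (n k) → E3))
      (hsep : ∀ (k : ℕ) (j l : Fin (n k)), j ≠ l → δLJ ≤ dist (x k j) (x k l)),
      (∀ k, 0 < n k) →
      ∃ φ : ℕ → ℕ, StrictMono φ ∧ ∃ Q : Measure Cfg, IsProbabilityMeasure Q ∧
        (∀ f : Cfg → ℝ, Continuous f →
          Tendsto (fun j => ∫ S, f S ∂(empirical (x (φ j)) (hsep (φ j)))) atTop (𝓝 (∫ S, f S ∂Q))) ∧
        (∀ U : Set Cfg, IsOpen U → ∀ ρ : ℝ, ρ < (Q U).toReal →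
          ∀ᶠ j : ℕ in atTop, ρ * (n (φ j) : ℝ) ≤
            (Nat.card {i : Fin (n (φ j)) //
              RootedHardCoreConfig.ofFinite (x (φ j)) (hsep (φ j)) i ∈ U} : ℝ)) := by
  sorry

/-- **stub_tailBound** (M; uniform `r⁻⁶` tail of the root energy over `Cfg`).  For every `η > 0` there
is `L` such that for every rooted `δLJ`-hard-core configuration `S` and every finite set `T` of points of
`S` of norm `≥ L`, `∑_{y ∈ T} |V_LJ ‖y‖| ≤ η`.  Proof: `|V_LJ t| ≤ t⁻⁶/4` for `t ≥ 1`
(`abs_lennardJones_le`), dyadic shells `2^m L ≤ ‖y‖ < 2^{m+1} L` hold `≤ (2^{m+2}L/δLJ + 1)³` points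
(`card_le_of_separated_of_dist_le`), so the tail is `≤ C/(δLJ³ L³)`. -/
theorem stub_tailBound :
    ∀ η : ℝ, 0 < η → ∃ L : ℝ, ∀ (S : Cfg) (T : Finset E3), (↑T ⊆ pts S) → (∀ y ∈ T, L ≤ ‖y‖) →
      ∑ y ∈ T, |lennardJones ‖y‖| ≤ η := by
  sorry

/-- **stub_rootEnergyContinuous** (L; vague continuity of the root energy).  Given the uniform tail
bound of `stub_tailBound`, `rootEnergyC : Cfg → ℝ` is continuous.  Proof: `0 ∈ S` and `δLJ`-separation put
no point of `S` in `B(0, δLJ) ∖ {0}`, so `V_LJ ‖y‖ = Ṽ ‖y‖` on `S` for a CONTINUOUS `Ṽ` vanishing near `0`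
(`lennardJones_zero`); the truncations `S ↦ ∑_{y ∈ S} Ṽ(‖y‖) χ_L(‖y‖)` are continuous
(`LocalConfig.continuous_integral_toMeasure`), converge uniformly by the tail bound, and the integral is the
sum (`UniformlyDiscrete.summable_lennardJones`-type integrability against `count|S`). -/
theorem stub_rootEnergyContinuous :
    (∀ η : ℝ, 0 < η → ∃ L : ℝ, ∀ (S : Cfg) (T : Finset E3), (↑T ⊆ pts S) → (∀ y ∈ T, L ≤ ‖y‖) →
      ∑ y ∈ T, |lennardJones ‖y‖| ≤ η) →
    Continuous rootEnergyC := by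
  sorry

/-- **stub_supportLocalLimit** (L; the limit law lives on `𝔏`).  If `Q` is a probability law on `Cfg`
receiving the open-set transfer from the empirical laws of Lennard-Jones GROUND STATES `x k` with
`n k → ∞` particles, then `Q`-a.e. configuration is a local limit of translated ground states
(`IsLocalLimitOfGroundStates lennardJones 3`).  Proof: for `S` in the topological support of `Q` every
basic open neighbourhood has positive mass, hence (transfer) eventually contains some `ofFinite (x k) _ i`,
i.e. `x k − x k i` matches `S` locally; a diagonal choice over a countable neighbourhood basis and
`IsLocalLimitOfGroundStates.of_eventually_ballMatch` / the definition (padding the family with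
`LennardJonesGroundStatesExist_holds`, particle numbers made strictly increasing using `n k → ∞`) give
`S ∈ 𝔏`; the complement of the support is a countable union of null basic opens (`Cfg` is second
countable). -/
theorem stub_supportLocalLimit :
    ∀ (n : ℕ → ℕ) (x : (k : ℕ) → (Fin (n k) → E3))
      (hsep : ∀ (k : ℕ) (j l : Fin (n k)), j ≠ l → δLJ ≤ dist (x k j) (x k l)),
      (∀ k, IsGroundState lennardJones (x k)) → Tendsto n atTop atTop →
      ∀ Q : Measure Cfg, IsProbabilityMeasure Q →
        (∀ U : Set Cfg, IsOpen U → ∀ ρ : ℝ, ρ < (Q U).toReal →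
          ∀ᶠ k : ℕ in atTop, ρ * (n k : ℝ) ≤
            (Nat.card {i : Fin (n k) // RootedHardCoreConfig.ofFinite (x k) (hsep k) i ∈ U} : ℝ)) →
        ∀ᵐ S ∂Q, IsLocalLimitOfGroundStates lennardJones 3 (pts S) := by
  sorry

/-- **stub_empiricalStationary** (M; exact finite Mecke identity).  The uniformly re-rooted empirical law
of a finite `δLJ`-separated configuration is point-stationary on `Cfg`: both sides of the identity are
`(1/n) ∑ᵢ ∑ₖ g(S_i, x_k − x_i)` after `rerootAt S_i (x_k − x_i) = S_k` and the swap `i ↔ k`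
(`lintegral_finset_sum_measure`, `lintegral_dirac`, `cfgMeasure (ofFinite x _ i) = count|range (x · − x i)`
is a finite sum of Dirac masses, `count_restrict_finset_eq_sum_dirac`). -/
theorem stub_empiricalStationary :
    ∀ (n : ℕ) (x : Fin n → E3) (hsep : ∀ j k : Fin n, j ≠ k → δLJ ≤ dist (x j) (x k)),
      IsPointStationaryC (empirical x hsep) := by
  sorry

/-- **stub_stationaryClosed** (L–XL; the lead's own stub).  Point-stationarity on `Cfg` is closed under
weak convergence of probability laws.  Proof plan: the Campbell measures `Λ_Q = Q ⊗ κ`, `κ S = count|S`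
(an s-finite kernel by the uniform packing bound), and their images under the measurable involution
`Θ(S, y) = (rerootAt S y, −y)`; for `G` continuous on `Cfg × ℝ³` with bounded `y`-support,
`S ↦ ∑_{y ∈ S} G(S, y)` and `S ↦ ∑_{y ∈ S} G(S − y, −y)` are continuous (fine matchings are bijections
near the support; re-rooting along a matching stays close), so `∫ G dΛ_{P_j} → ∫ G dΛ_Q` and likewise for
`G ∘ Θ`; `Λ_{P_j} = Θ_* Λ_{P_j}` by hypothesis, hence `∫ G dΛ_Q = ∫ G ∘ Θ dΛ_Q`; locally finite measures on
the metric space `Cfg × ℝ³` agreeing on such `G` are equal (closed `y`-bounded sets form a generating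
π-system; thickened indicators), which is the identity for all measurable `g`. -/
theorem stub_stationaryClosed :
    ∀ (P : ℕ → Measure Cfg) (Q : Measure Cfg), (∀ j, IsProbabilityMeasure (P j)) →
      IsProbabilityMeasure Q → (∀ j, IsPointStationaryC (P j)) →
      (∀ f : Cfg → ℝ, Continuous f → Tendsto (fun j => ∫ S, f S ∂(P j)) atTop (𝓝 (∫ S, f S ∂Q))) →
      IsPointStationaryC Q := by
  sorry

/-- **stub_palmCoarseHcp** (THE LOAD-BEARING STUB — the idea's Transfer `C⁺`, crystallization-strength,
open).  For every radius `R > 0`: a probability law `Q` on rooted `δLJ`-hard-core configurations of `ℝ³`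
which is POINT-STATIONARY (`IsPointStationaryC`), almost surely carried by local limits of translated
Lennard-Jones ground states (`𝔏`), and MINIMISING (`E_Q[rootEnergyC] ≤ e* = ⨅_Q e(Q)`) charges the
hcp-grain event `GrainSet R` ("no minimising point-stationary hard-core phase is hcp-free at
`(1/41, R + 1)`").  Why plausible / why it might fail: see the line card (every hcp-free competitor —
rooted clusters, cluster gases, fcc and polytypes by the Hägg margin, elastically modulated hcp — is
non-minimising by a strict energy-density inequality, linear in `Q`; positive densities of vacancies or
faults are allowed; barriers IcosahedralClusters / TetrahedralFrustration / ShortRangeStackingBlindness bite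
here and only here).  Documented attack: sandwich from `PalmUnimodularRigidity.PalmRigidity` (stmt-9224)
plus the certified window pin, or the Palm-side coercivity inequality
`E_Q[h] − e* ≥ κ_R · Q(no grain within 1 of the root)`. -/
theorem stub_palmCoarseHcp :
    ∀ R : ℝ, 0 < R → ∀ Q : Measure Cfg, IsProbabilityMeasure Q → IsPointStationaryC Q →
      (∀ᵐ S ∂Q, IsLocalLimitOfGroundStates lennardJones 3 (pts S)) →
      (∫ S, rootEnergyC S ∂Q) ≤ eStar → 0 < Q (GrainSet R) := by
  sorry

/-! ### Proved glue 1: the energy identity `E(n)/n = ∫ rootEnergyC d(empirical)` and `E(N)/N ≤ 0` -/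

/-- Separated configurations are injective. [folklore] -/
theorem injective_of_sep {n : ℕ} {x : Fin n → E3}
    (hsep : ∀ j k : Fin n, j ≠ k → δLJ ≤ dist (x j) (x k)) : Function.Injective x := by
  intro j k hjk
  by_contra hne
  have h := hsep j k hne
  rw [hjk, dist_self] at h
  exact absurd h (not_le.2 δLJ_pos)

/-- Integration against the empirical law is the uniform average over the roots. [folklore] -/
theorem integral_empirical {n : ℕ} (x : Fin n → E3)
    (hsep : ∀ j k : Fin n, j ≠ k → δLJ ≤ dist (x j) (x k)) (f : Cfg → ℝ) :
    ∫ S, f S ∂(empirical x hsep) =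
      (n : ℝ)⁻¹ * ∑ i : Fin n, f (RootedHardCoreConfig.ofFinite x hsep i) := by
  unfold empirical
  rw [integral_smul_measure, integral_finsetSum_measure fun i _ =>
    integrable_dirac (by simp)]
  simp only [integral_dirac]
  rw [smul_eq_mul, ENNReal.toReal_inv, ENNReal.toReal_natCast]

/-- **The energy identity**: for a finite `δLJ`-separated configuration with `n ≥ 1` particles,
`∫ rootEnergyC d(empirical x) = 𝓔_LJ(x)/n` (`interactionEnergy_div_eq_avg_rootEnergy_lennardJones`;
`cfgMeasure (ofFinite x _ i) = count|{x_k − x_i | k}` by `rfl`). [folklore] -/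
theorem integral_rootEnergyC_empirical {n : ℕ} (x : Fin n → E3)
    (hsep : ∀ j k : Fin n, j ≠ k → δLJ ≤ dist (x j) (x k)) :
    ∫ S, rootEnergyC S ∂(empirical x hsep) = interactionEnergy lennardJones x / n := by
  rw [integral_empirical, interactionEnergy_div_eq_avg_rootEnergy_lennardJones (injective_of_sep hsep)]
  rfl

/-- `V_LJ(r) ≤ 0` for `r ≥ 1`. [folklore] -/
theorem lennardJones_nonpos_of_one_le {r : ℝ} (hr : 1 ≤ r) : lennardJones r ≤ 0 :=
  lennardJones_nonpos hr

/-- `E(N) ≤ 0`: `N` collinear points at mutual distances `≥ 2` have non-positive energy. [folklore] -/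
theorem groundStateEnergy_lennardJones_nonpos (N : ℕ) : groundStateEnergy lennardJones 3 N ≤ 0 := by
  obtain ⟨e, he⟩ : ∃ e : E3, ‖e‖ = 1 := exists_norm_eq E3 zero_le_one
  have he0 : e ≠ 0 := by
    intro h
    rw [h, norm_zero] at he
    exact zero_ne_one he
  let x : Fin N → E3 := fun i => ((2 : ℝ) * (i : ℕ)) • e
  have hx : Function.Injective x := by
    intro i j hij
    have h2 : (2 : ℝ) * (i : ℕ) = (2 : ℝ) * (j : ℕ) := smul_left_injective ℝ he0 hij
    have h3 : ((i : ℕ) : ℝ) = ((j : ℕ) : ℝ) := by linarith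
    exact Fin.ext (Nat.cast_injective h3)
  have hdist : ∀ i j : Fin N, i ≠ j → 1 ≤ dist (x i) (x j) := by
    intro i j hij
    have hne : (i : ℕ) ≠ (j : ℕ) := fun h => hij (Fin.ext h)
    have hd : dist (x i) (x j) = |(2 : ℝ) * (i : ℕ) - 2 * (j : ℕ)| := by
      change dist (((2 : ℝ) * (i : ℕ)) • e) (((2 : ℝ) * (j : ℕ)) • e) = _
      rw [dist_eq_norm, ← sub_smul, norm_smul, he, mul_one, Real.norm_eq_abs]
    rw [hd]
    rcases Nat.lt_or_gt_of_ne hne with h | h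
    · have h' : ((i : ℕ) : ℝ) + 1 ≤ ((j : ℕ) : ℝ) := by exact_mod_cast h
      rw [abs_of_nonpos (by linarith)]
      linarith
    · have h' : ((j : ℕ) : ℝ) + 1 ≤ ((i : ℕ) : ℝ) := by exact_mod_cast h
      rw [abs_of_nonneg (by linarith)]
      linarith
  have hE : interactionEnergy lennardJones x ≤ 0 := by
    unfold interactionEnergy
    refine Finset.sum_nonpos fun i _ => Finset.sum_nonpos fun j hj => ?_
    have hij : i ≠ j := (Finset.mem_Ioi.1 hj).ne
    exact lennardJones_nonpos_of_one_le (hdist i j hij)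
  exact (groundStateEnergy_lennardJones_le hx).trans hE

/-- Hence `E(N)/N ≤ 0`. [folklore] -/
theorem groundStateEnergy_div_nonpos (N : ℕ) :
    groundStateEnergy lennardJones 3 N / (N : ℝ) ≤ 0 :=
  div_nonpos_of_nonpos_of_nonneg (groundStateEnergy_lennardJones_nonpos N) (Nat.cast_nonneg N)

/-- **The trial-state bound** `limsup E(N)/N ≤ e*` — in one line from the PROVED `CrysEnergyLimit`
(stmt-0626, `ChargedEnergyGapNegative.crysEnergyLimit`: `E(N)/N → e*`).  (This was the planner's registered
`stub_energyUpperBound`; it is no longer a stub.) [folklore] -/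
theorem energyUpperBound :
    Filter.limsup (fun N : ℕ => groundStateEnergy lennardJones 3 N / (N : ℝ)) atTop ≤ eStar :=
  (Theorems.ChargedEnergyGapNegative.crysEnergyLimit.limsup_eq).le

/-! ### Proved glue 2: translation covariance and the margin portmanteau `1/41 + 1/1640 = 1/40` -/

/-- `Inner` only sees the inner displacement `t 1 − t 0`: translating both sublattices is free.
[folklore] -/
theorem inner_translate {t : Fin 2 → E3} {A : E3 →L[ℝ] E3} (v : E3) (h : Inner t A) :
    Inner (fun m => t m + v) A := by
  unfold Theorems.CoarseGrains.Negative.PredicateAPI.Inner at h ⊢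
  have : t 1 + v - (t 0 + v) = t 1 - t 0 := by abel
  rw [this]
  exact h

/-- **Translation covariance of `Near`**: a grain of the configuration recentred at `x i` is a grain of
the configuration itself, with centre and sublattice translations shifted by `x i`. [folklore] -/
theorem near_translate {N : ℕ} (x : Fin N → E3) (i : Fin N) {c : E3} {r : ℝ} {t : Fin 2 → E3}
    {A : E3 →L[ℝ] E3} {ε : ℝ} (h : Near (Set.range fun k => x k - x i) c r t A ε) :
    Near (Set.range x) (c + x i) r (fun m => t m + x i) A ε := by
  constructor
  · rintro p ⟨k, rfl⟩ hpc
    have h1 : x k - x i ∈ Set.range fun k => x k - x i := ⟨k, rfl⟩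
    have h2 : dist (x k - x i) c ≤ r := by
      rwa [dist_sub_eq_dist_add, add_comm]
    obtain ⟨m, z, hz, hd⟩ := h.1 _ h1 h2
    refine ⟨m, z, hz, ?_⟩
    have : t m + x i + A z = x i + (t m + A z) := by abel
    rwa [this, ← dist_sub_eq_dist_add]
  · intro m z hz hd
    have hd' : dist (t m + A z) c ≤ r := by
      have : t m + x i + A z = (t m + A z) + x i := by abel
      rwa [this, dist_add_right] at hd
    obtain ⟨p, ⟨k, rfl⟩, hpk⟩ := h.2 m z hz hd'
    refine ⟨x k, ⟨k, rfl⟩, ?_⟩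
    have : t m + x i + A z = x i + (t m + A z) := by abel
    rwa [this, ← dist_sub_eq_dist_add]

/-- **Margin portmanteau** (`T_{1/41,R+1} ⊂ int T_{1/40,R}`): if the point set `Y` carries an
`(η, R + 1)`-grain centred at `c` with `‖c‖ ≤ L`, and `X` is two-way `ε`-matched with `Y` on the ball
`‖·‖ ≤ R'`, `R' ≥ L + R + 1`, `ε, η ≤ 1`, then `X` carries the `(η', R)`-grain with the SAME datum
`(c, t, A)` whenever `η + ε ≤ η'`. [folklore] -/
theorem near_of_locallyMatches {X Y : Set E3} {c : E3} {t : Fin 2 → E3}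
    {A : E3 →L[ℝ] E3} {L R R' ε η η' : ℝ} (hε : ε ≤ 1) (hη : η ≤ 1)
    (hR' : L + R + 1 ≤ R') (hsum : η + ε ≤ η') (hc : ‖c‖ ≤ L)
    (hν : Near Y c (R + 1) t A η) (hm : LocallyMatches R' ε X Y) :
    Near X c R t A η' := by
  constructor
  · intro p' hp' hp'c
    have hnorm : ‖p'‖ ≤ R' := by
      have h1 : ‖p'‖ ≤ dist p' c + ‖c‖ := by
        calc ‖p'‖ = ‖(p' - c) + c‖ := by rw [sub_add_cancel]
          _ ≤ ‖p' - c‖ + ‖c‖ := norm_add_le _ _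
          _ = dist p' c + ‖c‖ := by rw [dist_eq_norm]
      linarith
    obtain ⟨p, hp, hpp'⟩ := hm.2 p' hp' hnorm
    have hpc : dist p c ≤ R + 1 := by
      have := dist_triangle p p' c
      rw [dist_comm p p'] at this
      linarith
    obtain ⟨m, z, hz, hd⟩ := hν.1 p hp hpc
    refine ⟨m, z, hz, ?_⟩
    have := dist_triangle p' p (t m + A z)
    linarith
  · intro m z hz hsc
    have hsc' : dist (t m + A z) c ≤ R + 1 := by linarith
    obtain ⟨p, hp, hps⟩ := hν.2 m z hz hsc'
    have hnorm : ‖p‖ ≤ R' := by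
      calc ‖p‖ = ‖(p - (t m + A z)) + ((t m + A z) - c) + c‖ := by congr 1; abel
        _ ≤ ‖p - (t m + A z)‖ + ‖(t m + A z) - c‖ + ‖c‖ := norm_add₃_le
        _ = dist p (t m + A z) + dist (t m + A z) c + ‖c‖ := by rw [dist_eq_norm, dist_eq_norm]
        _ ≤ η + R + L := by linarith
        _ ≤ R' := by linarith
    obtain ⟨q, hq, hqp⟩ := hm.1 p hp hnorm
    refine ⟨q, hq, ?_⟩
    have := dist_triangle q p (t m + A z)
    linarith

/-! ### Proved glue 3: the localised grain events and their open fattenings in `Cfg` -/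

/-- The grain event localised to centres of norm `≤ L`. [folklore] -/
def TLoc (R : ℝ) (L : ℕ) : Set Cfg :=
  {S | ∃ c : E3, ‖c‖ ≤ (L : ℝ) ∧ ∃ (t : Fin 2 → E3) (A : E3 →L[ℝ] E3),
    Adm A ∧ Inner t A ∧ Near (pts S) c (R + 1) t A (1 / 41)}

/-- The open fattening of `TLoc R L` in the local rubber topology: configurations strictly better than
`(L + R + 1, 1/1640)`-matched with a member of `TLoc R L`. [folklore] -/
def ULoc (R : ℝ) (L : ℕ) : Set Cfg :=
  {S' | ∃ S ∈ TLoc R L, ∃ R' ε' : ℝ, (L : ℝ) + R + 1 < R' ∧ 0 ≤ ε' ∧ ε' < 1 / 1640 ∧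
    LocallyMatches R' ε' (pts S) (pts S')}

/-- `GrainSet R ⊆ ⋃_L TLoc R L`. [folklore] -/
theorem grainSet_subset_iUnion (R : ℝ) : GrainSet R ⊆ ⋃ L : ℕ, TLoc R L := by
  rintro S ⟨c, t, A, hA, hI, hN⟩
  exact Set.mem_iUnion.2 ⟨⌈‖c‖⌉₊, c, Nat.le_ceil _, t, A, hA, hI, hN⟩

/-- `TLoc R L ⊆ ULoc R L` (a configuration matches itself exactly). [folklore] -/
theorem tLoc_subset_uLoc (R : ℝ) (L : ℕ) : TLoc R L ⊆ ULoc R L := fun S hS =>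
  ⟨S, hS, (L : ℝ) + R + 2, 0, by linarith, le_rfl, by norm_num, locallyMatches_self le_rfl _ _⟩

/-- `ULoc R L` is open in `Cfg` (`LocalConfig.isOpen_setOf_locallyMatches`). [folklore] -/
theorem isOpen_uLoc (R : ℝ) (L : ℕ) : IsOpen (ULoc R L) := by
  have h : ULoc R L = Subtype.val ⁻¹' ⋃ S ∈ TLoc R L,
      {T : LocalConfig E3 | ∃ R' ε' : ℝ, (L : ℝ) + R + 1 < R' ∧ 0 ≤ ε' ∧ ε' < 1 / 1640 ∧
        LocallyMatches R' ε' (pts S) (T : Set E3)} := by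
    ext S'
    simp only [ULoc, Set.mem_setOf_eq, Set.mem_preimage, Set.mem_iUnion, exists_prop]
  rw [h]
  exact (isOpen_biUnion fun S _ => LocalConfig.isOpen_setOf_locallyMatches _ _ _).preimage
    continuous_subtype_val

/-! ### The composition -/

/-- **Composition** (sorry-free, standard axioms).  The seven stub statements imply the crux — stated in
the unfolded form of `PredicateAPI.coarseGrains_iff` so that `CoarseGrains_of` below is the unique theorem of
the file whose conclusion is the route decl itself. -/
theorem coarseGrains_of_stubs
    (h₁ : ∀ (n : ℕ → ℕ) (x : (k : ℕ) → (Fin (n k) → E3))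
      (hsep : ∀ (k : ℕ) (j l : Fin (n k)), j ≠ l → δLJ ≤ dist (x k j) (x k l)),
      (∀ k, 0 < n k) →
      ∃ φ : ℕ → ℕ, StrictMono φ ∧ ∃ Q : Measure Cfg, IsProbabilityMeasure Q ∧
        (∀ f : Cfg → ℝ, Continuous f →
          Tendsto (fun j => ∫ S, f S ∂(empirical (x (φ j)) (hsep (φ j)))) atTop (𝓝 (∫ S, f S ∂Q))) ∧
        (∀ U : Set Cfg, IsOpen U → ∀ ρ : ℝ, ρ < (Q U).toReal →
          ∀ᶠ j : ℕ in atTop, ρ * (n (φ j) : ℝ) ≤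
            (Nat.card {i : Fin (n (φ j)) //
              RootedHardCoreConfig.ofFinite (x (φ j)) (hsep (φ j)) i ∈ U} : ℝ)))
    (h₂ : ∀ η : ℝ, 0 < η → ∃ L : ℝ, ∀ (S : Cfg) (T : Finset E3), (↑T ⊆ pts S) → (∀ y ∈ T, L ≤ ‖y‖) →
      ∑ y ∈ T, |lennardJones ‖y‖| ≤ η)
    (h₃ : (∀ η : ℝ, 0 < η → ∃ L : ℝ, ∀ (S : Cfg) (T : Finset E3), (↑T ⊆ pts S) → (∀ y ∈ T, L ≤ ‖y‖) →
      ∑ y ∈ T, |lennardJones ‖y‖| ≤ η) → Continuous rootEnergyC)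
    (h₄ : ∀ (n : ℕ → ℕ) (x : (k : ℕ) → (Fin (n k) → E3))
      (hsep : ∀ (k : ℕ) (j l : Fin (n k)), j ≠ l → δLJ ≤ dist (x k j) (x k l)),
      (∀ k, IsGroundState lennardJones (x k)) → Tendsto n atTop atTop →
      ∀ Q : Measure Cfg, IsProbabilityMeasure Q →
        (∀ U : Set Cfg, IsOpen U → ∀ ρ : ℝ, ρ < (Q U).toReal →
          ∀ᶠ k : ℕ in atTop, ρ * (n k : ℝ) ≤
            (Nat.card {i : Fin (n k) // RootedHardCoreConfig.ofFinite (x k) (hsep k) i ∈ U} : ℝ)) →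
        ∀ᵐ S ∂Q, IsLocalLimitOfGroundStates lennardJones 3 (pts S))
    (h₅ : ∀ (n : ℕ) (x : Fin n → E3) (hsep : ∀ j k : Fin n, j ≠ k → δLJ ≤ dist (x j) (x k)),
      IsPointStationaryC (empirical x hsep))
    (h₆ : ∀ (P : ℕ → Measure Cfg) (Q : Measure Cfg), (∀ j, IsProbabilityMeasure (P j)) →
      IsProbabilityMeasure Q → (∀ j, IsPointStationaryC (P j)) →
      (∀ f : Cfg → ℝ, Continuous f → Tendsto (fun j => ∫ S, f S ∂(P j)) atTop (𝓝 (∫ S, f S ∂Q))) →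
      IsPointStationaryC Q)
    (h₇ : ∀ R : ℝ, 0 < R → ∀ Q : Measure Cfg, IsProbabilityMeasure Q → IsPointStationaryC Q →
      (∀ᵐ S ∂Q, IsLocalLimitOfGroundStates lennardJones 3 (pts S)) →
      (∫ S, rootEnergyC S ∂Q) ≤ eStar → 0 < Q (GrainSet R)) :
    ∀ R : ℝ, 0 < R → ∃ N₀ : ℕ, ∀ N : ℕ, N₀ ≤ N → ∀ x : Fin N → E3,
      IsGroundState lennardJones x →
        ∃ (c : E3) (t : Fin 2 → E3) (A : E3 →L[ℝ] E3),
          Adm A ∧ Inner t A ∧ Near (Set.range x) c R t A (1 / 40) := by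
  classical
  intro R hR
  by_contra H
  push Not at H
  -- grain-free ground states `x k` with `n k ≥ k + 1` particles
  have H' : ∀ k : ℕ, ∃ N : ℕ, k + 1 ≤ N ∧ ∃ x : Fin N → E3, IsGroundState lennardJones x ∧
      ∀ (c : E3) (t : Fin 2 → E3) (A : E3 →L[ℝ] E3), Adm A → Inner t A →
        ¬ Near (Set.range x) c R t A (1 / 40) := fun k => H (k + 1)
  choose n hn x hx hbad using H'
  have hnpos : ∀ k, 0 < n k := fun k => Nat.lt_of_lt_of_le (Nat.succ_pos k) (hn k)
  have hn' : Tendsto n atTop atTop :=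
    tendsto_atTop_mono (fun k => (Nat.le_succ k).trans (hn k)) tendsto_id
  have hsep : ∀ (k : ℕ) (j l : Fin (n k)), j ≠ l → δLJ ≤ dist (x k j) (x k l) :=
    fun k => δLJ_sep (hx k)
  -- (1) Benjamini–Schramm limit along a subsequence
  obtain ⟨φ, hφ, Q, hQ, hweak, htr⟩ := h₁ n x hsep hnpos
  -- (2) the limit law is minimising
  have hcont : Continuous rootEnergyC := h₃ h₂
  have hE : Tendsto (fun j : ℕ => groundStateEnergy lennardJones 3 (n (φ j)) / (n (φ j) : ℝ)) atTop
      (𝓝 (∫ S, rootEnergyC S ∂Q)) := by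
    have h := hweak rootEnergyC hcont
    refine h.congr fun j => ?_
    rw [integral_rootEnergyC_empirical, (hx (φ j)).2]
  have hmin : (∫ S, rootEnergyC S ∂Q) ≤ eStar := by
    refine le_trans ?_ energyUpperBound
    have hv : Tendsto (fun j : ℕ => n (φ j)) atTop atTop := hn'.comp hφ.tendsto_atTop
    have hcomp : Filter.limsup ((fun N : ℕ => groundStateEnergy lennardJones 3 N / (N : ℝ)) ∘
        fun j : ℕ => n (φ j)) atTop ≤
        Filter.limsup (fun N : ℕ => groundStateEnergy lennardJones 3 N / (N : ℝ)) atTop :=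
      hv.limsup_comp_le_limsup (tendsto_map'_iff.2 hE).isCoboundedUnder_le
        (isBoundedUnder_of ⟨0, fun N => groundStateEnergy_div_nonpos N⟩)
    rw [← hE.limsup_eq]
    exact hcomp
  -- (3) the limit law is point-stationary and carried by `𝔏`
  have hstat : IsPointStationaryC Q :=
    h₆ (fun j => empirical (x (φ j)) (hsep (φ j))) Q (fun j => by
      refine ⟨?_⟩
      have h := integral_empirical (x (φ j)) (hsep (φ j)) (fun _ => (1 : ℝ))
      simp only [integral_const, smul_eq_mul, mul_one, Finset.sum_const, Finset.card_univ,
        Fintype.card_fin, nsmul_eq_mul, measureReal_def] at h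
      have hn0 : (n (φ j) : ℝ) ≠ 0 := Nat.cast_ne_zero.2 (hnpos (φ j)).ne'
      rw [inv_mul_cancel₀ hn0] at h
      have hfin : empirical (x (φ j)) (hsep (φ j)) Set.univ ≠ ⊤ := by
        unfold empirical
        simp [ENNReal.mul_eq_top]
      exact (ENNReal.toReal_eq_one_iff _).1 h |> fun h' => h') hQ
      (fun j => h₅ _ _ _) hweak
  have hLL : ∀ᵐ S ∂Q, IsLocalLimitOfGroundStates lennardJones 3 (pts S) :=
    h₄ (fun j => n (φ j)) (fun j => x (φ j)) (fun j => hsep (φ j)) (fun j => hx (φ j))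
      (hn'.comp hφ.tendsto_atTop) Q hQ htr
  -- (4) phase exclusion: the grain event has positive mass, hence so does a localised piece
  have hpos : 0 < Q (GrainSet R) := h₇ R hR Q hQ hstat hLL hmin
  obtain ⟨L, hL⟩ : ∃ L : ℕ, Q (TLoc R L) ≠ 0 := by
    by_contra hall
    push Not at hall
    have h0 : Q (⋃ L : ℕ, TLoc R L) = 0 := (measure_iUnion_null_iff).2 hall
    exact hpos.ne' (measure_mono_null (grainSet_subset_iUnion R) h0)
  -- (5) the open fattening has positive mass; transfer along the subsequence
  have hU : Q (ULoc R L) ≠ 0 := fun h0 => hL (measure_mono_null (tLoc_subset_uLoc R L) h0)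
  haveI := hQ
  have hρ : 0 < (Q (ULoc R L)).toReal := ENNReal.toReal_pos hU (measure_ne_top Q _)
  obtain ⟨j, hj⟩ := (htr (ULoc R L) (isOpen_uLoc R L) ((Q (ULoc R L)).toReal / 2)
    (half_lt_self hρ)).exists
  have hcard : (0 : ℝ) < Nat.card {i : Fin (n (φ j)) //
      RootedHardCoreConfig.ofFinite (x (φ j)) (hsep (φ j)) i ∈ ULoc R L} := by
    have : 0 < (Q (ULoc R L)).toReal / 2 * (n (φ j) : ℝ) := by
      have : (0 : ℝ) < n (φ j) := by exact_mod_cast hnpos (φ j)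
      positivity
    linarith
  have hne : Nonempty {i : Fin (n (φ j)) //
      RootedHardCoreConfig.ofFinite (x (φ j)) (hsep (φ j)) i ∈ ULoc R L} := by
    have h' : Nat.card {i : Fin (n (φ j)) //
        RootedHardCoreConfig.ofFinite (x (φ j)) (hsep (φ j)) i ∈ ULoc R L} ≠ 0 := by
      intro h0
      rw [h0, Nat.cast_zero] at hcard
      exact lt_irrefl _ hcard
    exact (Nat.card_ne_zero.1 h').1
  obtain ⟨⟨i, S, hST, R', ε', hR', hε'0, hε', hmatch⟩⟩ := hne
  obtain ⟨c, hc, t, A, hA, hI, hN⟩ := hST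
  -- (6) margin portmanteau and translation back: particle `i` carries a `(1/40, R)`-grain
  have hmatch' : LocallyMatches ((L : ℝ) + R + 1) (1 / 1640)
      (Set.range fun k : Fin (n (φ j)) => x (φ j) k - x (φ j) i) (pts S) :=
    (hmatch.symm).mono hR'.le hε'.le
  have hgrain : Near (Set.range fun k : Fin (n (φ j)) => x (φ j) k - x (φ j) i) c R t A (1 / 40) :=
    near_of_locallyMatches (by norm_num) (by norm_num) le_rfl (by norm_num) hc hN hmatch'
  exact hbad (φ j) (c + x (φ j) i) (fun m => t m + x (φ j) i) A hA (inner_translate _ hI)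
    (near_translate (x (φ j)) i hgrain)

/-- **The crux BY NAME from the registered stubs.**  The kernel checks here that the composition reaches
the route decl `ExcessDecayLiouville.CoarseGrains` (`PredicateAPI.coarseGrains_iff` is `Iff.rfl`); the only
`sorry`s in its cone are the seven stubs. -/
theorem CoarseGrains_of :
    Summit.AtomisticToContinuum.Crystallization.Theses.ExcessDecayLiouville.CoarseGrains :=
  coarseGrains_iff.2 (coarseGrains_of_stubs stub_bsLimit stub_tailBound stub_rootEnergyContinuous
    stub_supportLocalLimit stub_empiricalStationary stub_stationaryClosed stub_palmCoarseHcp)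

end Summit.AtomisticToContinuum.Crystallization.Cruxes.CoarseGrains.HcpFreePhaseExclusion

end
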